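import Mathlib
import HarnessLib
import HarnessLib.Audit
import Summits.AnomalousDissipation.Statement
import HarnessLib.Audit.Status.Attr

/-!
Route: FiniteIntersection

DORMANT since 2026-08-21T07:20:29Z (reconciler: no traction for 5 d (last activity statement-checked at 2026-08-16T06:52:51Z); parked, not closed — `ledger route dormant route-AnomalousDissipation-FiniteIntersection --off` to reactivate) — unstaffed, not closed; items shared with open routes are served there. `ledger route dormant <id> --off` reactivates.

Thesis X (FiniteViscosityMultiplexing, FM; idea card nu-independence-finite-intersection). It
suffices to show: there are a
sequence ν_j → 0 (ν_j > 0), a C^∞ force box B_R = {f smooth, div-free, mean-zero : sup|∂^k(lift f)|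
≤ R_k ∀k}, budgets E, ε > 0 and
rung ladders (τmax_j, M_{j,k}) such that FOR EVERY N some force f_N ∈ B_R (allowed to depend on N)
drives, at EACH of the finitely many
viscosities ν_0, …, ν_N, a classical time-periodic Navier–Stokes solution on ℝ × T³ (period ≤
τmax_j, all space-time derivatives
≤ M_{j,k}) with limsup-mean energy ≤ E and limsup-mean dissipation ≥ ε ("N viscosities, one force",
uniform budgets).
X → AnomalousDissipation is SOFT: B_R is sequentially compact for uniform convergence
(Arzelà–Ascoli, support CompactForceBox); at
FIXED ν > 0 the set K_ν of box forces carrying such a loud bounded regular orbit is closed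
(Arzelà–Ascoli on the orbits, smooth
convergence so energy AND dissipation pass with equality, support ClosedLoudSet); K_{ν_0} ∩ … ∩
K_{ν_N} ∋ f_N is nonempty for every
N, so a diagonal limit f* lies in every K_{ν_j} (finite-intersection property) — that is verbatim
the CoherentStates target
(one steady smooth force, periodic classical solutions at ν_j → 0, bounded mean energy, mean
dissipation ≥ ε), which implies
AnomalousDissipation by the PROVED cone theorems
AnomalousDissipation.CoherentStates.coherent_assembly_fact and
Literature.Analysis.FluidPDE.Torus.isGlobalLerayHopf_of_isClassicalNSSolutionOn_holds.
ν-independence of the force costs nothing;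
all content is the uniformity of (E, ε, ladders) in N with the force free per N.
Lean (one line, elaborates rc 0 in planner Sketch.lean):
∃ (ν R τmax : ℕ → ℝ) (M : ℕ → ℕ → ℝ) (E ε : ℝ), (∀ j, 0 < ν j) ∧ Tendsto ν atTop (nhds 0) ∧ 0 < ε ∧
∀ N, ∃ f, (Torus.IsSmooth f ∧
Torus.IsDivFree f ∧ Torus.HasZeroMean f ∧ ∀ k y, ‖iteratedFDeriv ℝ k (Torus.lift f) y‖ ≤ R k) ∧ ∀ j
≤ N, ∃ τ u p, 0 < τ ∧ τ ≤ τmax j ∧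
Torus.IsClassicalNSSolutionOn univ (ν j) (fun _ => f) u p ∧ Periodic u τ ∧ (∀ k z, ‖iteratedFDeriv ℝ
k (Torus.stLift u) z‖ ≤ M j k) ∧
meanEnergy u ≤ E ∧ ε ≤ meanDissipation (ν j) u.

Rationale: WHY THIS LINE (point-set topology / compactness brought to bear on the force axis; precedent: de
Bruijn–Erdős compactness
"k-colourable iff every finite subgraph is" [DebruijnErdos1951] with the dictionary vertex ↦
viscosity rung, colouring space k^V ↦
compact force box B_R, "properly coloured on F" (clopen) ↦ "loud regular bounded orbit at each rung
of F" (closed at fixed ν)).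
The residual difficulty named by BrueDeLellis2023 Q2.1, Cheskidov2023 §1.2/Thm 1.3 and
CoherentStates 0220 ("f^ν → f, the force may
not depend on ν") is EXACTLY a finite-intersection property once loudness is recorded in a class
closed at fixed ν. We run the
card's K_J/FIP in CoherentStates' periodic-orbit class, not in Foias–Prodi measures (card as
written): there injection-form
loudness is needed for closedness and injection ⇏ dissipation in 3-D (only energy_le), plus
Ensemble's realisation crux 0215;
here ladders (period bound, C^k bounds per rung, free to blow up in j) make closedness elementary,
let dissipation pass WITH
EQUALITY, and realisation is the proved CoherentStates assembly. Honest corollary: in this class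
CoherentThesis(0218) ⟺ FM
(⇐ is this route; ⇒ trivial, f_N := f), i.e. an equivalent re-decomposition of 0218 whose one new
freedom is "f may depend on N".
Each FIXED rung FM_N alone is trivial (Leray–Schauder steady states ∀ν, dissipation (f,u_ν) > 0):
all content is UNIFORMITY of
(E, ε, ladders) in N. Numerics: UPOs continued in ν reproduce turbulent ε [VanVeenKidaKawahara2006
pp.6–7: Kida flow, 0.0035<ν<0.0045,
'about half the continuations ended in a bifurcation point' — the ladder issue], body-forced 3-D
recurrent flows [LucasKerswell2017,
VeenGoto2016], ε-plateau [KanedaEtAl2003, GotoSaitoKawahara2017]; certification tech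
[BergBredenLessardVeen2021].
RANKED CRUXES. #2 SingleViscosityLoudness (SVL, rung 1): ∃ box, ν_j → 0, (E, ε): ∀ j SOME box force
has a loud bounded periodic
classical orbit at ν_j (force re-tunable per j). Necessary for FM and for CoherentThesis; strictly
beyond print — designer forces of
BrueDeLellis2023 Thm 1.1 / Cheskidov2023 Thm 2.1 leave every C¹ box (f^ν → f in C_tC^α only), so a
box force must let the
nonlinearity absorb the fine scales (for a K41 field ‖νΔu‖_{L²} ∼ ε^{3/4}ν^{-1/4} → ∞, so
P(u·∇u)+∂_t u must cancel it). #3 ViscosityStacking := SVL → FM: couple finitely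
many viscosities with ONE box force under N-uniform ladders — ν-independence in finitary form; the
box is convex but the loud sets
K_ν are not, so no Helly/KKM is available; the physical bet (K41: every non-degenerate O(1) force is
loud at all large Re, UPOs dense
in the attractor) says K_ν is co-small, far more than non-empty.
SUPPORTS (provable now): ClosedLoudSet (Arzelà–Ascoli in C^∞_loc(ℝ×T³) for (u_n, p_n − mean), τ_n →
τ* ∈ [0, τmax] with τ* = 0 ⇒
steady ⇒ period τmax; budgets via the proved Literature.Turb.tendsto_timeMean_of_periodic +
gradNormSq_eq_toReal_eGradNormSq_holds);
CompactForceBox (Arzelà–Ascoli per k + diagonal; div/mean pass). ASSEMBLY = the FIP/diagonal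
argument + coherent_assembly_fact.
KILL CRITERIA: ¬SVL for every box (a theorem "uniformly-smooth steady forces cannot carry bounded
loud periodic orbits as ν → 0")
closes the route AND refutes CoherentThesis; a proof that N-uniform ladders are impossible (periods
or C^k norms of loud orbits
at fixed ν_j must blow up along any box sequence f_N) kills the periodic class — pivot: restate K_ν
over H²-supported stationary
statistical solutions (closed at fixed ν by Prokhorov + Wang2009-type u.s.c.; realisation via
Birkhoff) as a new route.
NOT DECOMPOSED YET: FM_2/FM_3 with budgets pinned at turbulent values as certified-numerics EVIDENCE
(radii polynomials,
BergBredenLessardVeen2021) — not a logical rung; quantitative closedness (modulus in f); the SSS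
variant; which box/forcing family
(Taylor–Green, Kolmogorov sin(2πmx₂)e₁, ABC). NOVELTY and BARRIERS: see the dedicated header
sections.

Novelty: NOVELTY (searched 2026-08-15 before claiming: `lit frontier AnomalousDissipation --since 2021` (30
descendants, none on force-space
topology); `lit search --hybrid` "unstable periodic orbit continuation Reynolds number energy
dissipation rate box turbulence steady
forcing Kida flow"; `lit vsearch` "by compactness of the set of admissible forces and a diagonal
argument a single body force works for
every viscosity provided for each finite set some force works" (0 relevant); crossref "continuity of
stationary statistical solutions
Navier-Stokes with respect to the forcing term" (FMRT ch. IV, Bakhtin 2006 small-force uniqueness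
only), "Wang upper semi-continuity
stationary statistical properties" (Wang2009 = doi:10.3934/dcds.2009.23.521), "three-dimensional
Kolmogorov flow periodic orbit van
Veen Goto" (VeenGoto2016, LucasKerswell2017, doi:10.1007/1-4020-4181-0_9); zbmath "single force all
Reynolds numbers diagonal
argument stationary statistical solutions dependence on force" (0 hits); galaxy pdf "unstable
periodic orbit"+title turbulence (15
hits, none relevant); `lit read arxiv:1804.00547` pp.5–7 (VanVeenKidaKawahara2006: forcing = FIXED
low-mode amplitudes, not a steady
body force; UPOs continued over 0.0035<ν<0.0045; half the continuations end in bifurcations;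
period-5 orbit tracks turbulent ε≈0.1);
the 114 hub cards + 7 route files of the sub (closest: force-robustness-has-a-sign = fixed-ν u.s.c.
for a FIXED force with vanishing
perturbations, graded variant; baire-transfe  [refs: 10.3934/dcds.2009.23.521, 10.1007/1-4020-4181-0_9, 1804.00547, doi:10.3934/dcds.2009.23.521, doi:10.1007/1-4020-4181-0_9, arxiv:1804.00547, Wang2009, VeenGoto2016, LucasKerswell2017, VanVeenKidaKawahara2006, FoiasTemam1977, FMRT2001, BrueDeLellis2023, Cheskidov2023, DebruijnErdos1951]

Barriers (technique_class: compactness-transfer force-space-topology upo): technique_class: compactness-transfer force-space-topology upo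
- Literature.Barriers.AnomalousDissipation.Cheskidov2023_thm13_not_forceRobustNoAnomaly: applies
only to NEGATIVE (no-anomaly) statements stable under C(ℝ;L²) force perturbations; this route's
items are positive witness statements (SVL, FM) and two soft lemmas; its kill criterion ¬SVL
quantifies over steady forces in a FIXED C^∞ box with ν-dependent periods — outside the refuted
class by scope caveats (a),(b),(d),(f) (Thm 1.3's forces are time-dependent and leave every C¹ box).
Not evaded by construction on the negative side: a proof of ¬SVL must USE box-smoothness/steadiness
of the force. The un-refuted residual recorded in the same file (ForceRobustNoAnomalyNarrow: smooth
limit forces) is exactly where ¬SVL-type theorems would live — the natural home of a refuter working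
SVL.
- Literature.Barriers.AnomalousDissipation.Cheskidov2023_thm21_noDissipationAnomaly: evaded by
design — dissipation is ν_j⟨‖∇u_j‖²⟩ of classical solutions at ν_j > 0 (period means), no
Euler-limit energy defect is ever taken; the only limits in the route are N → ∞ at FIXED ν
(ClosedLoudSet) and in the force box (CompactForceBox), where convergence is C^∞ and budgets pass
with equality ("compactness" here is in the FORCE, not a vanishing-viscosity compactness).
- Literature.Barriers.AnomalousDissipation.BrueDeLellis2023_noAnomaly_beforeEulerSingularity:
applies to the letter (classical solutions, one smooth ν-independent steady force = the O

Novelty grade: variant — ROUTE REVIEW (refuter-rreview-…-80a57a10-0, 2026-08-15). GRADE variant: by the planner's own 'honest corollary', FM ⟺ CoherentThesis (stmt-0218, route CoherentStates, OPEN) in this class — the route is a re-decomposition of 0218 whose one new freedom is 'the force may depend on N', closed back up by (refuter refuter-rreview-route-HubbardSuperconduc-80a57a10-0, 2026-08-15T11:23:47Z; prior: stmt-AnomalousDissipation-0218 (route CoherentStates), arXiv:2311.04182 Thm 1.3, arXiv:2207.06301 Thm 1.1, DebruijnErdos1951)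

History (route lifecycle, newest last):
- 2026-08-21T07:20:29Z · DORMANT — reconciler: no traction for 5 d (last activity statement-checked at 2026-08-16T06:52:51Z); parked, not closed — `ledger route dormant route-AnomalousDissipation (operator:999:3293442)

sub-problem: AnomalousDissipation · status: dormant · opened planner-plancard-AnomalousDissipation-Anomalo-4ad65e22-0 2026-08-15T10:54:41Z · rev 3 · ledger route-AnomalousDissipation-FiniteIntersection
GENERATED by the gate from the ledger (D-0016/17). Provers cite these decls: `theorem foo : Summit.AnomalousDissipation.AnomalousDissipation.Theses.FiniteIntersection.<Decl> := …` in Summits/AnomalousDissipation/AnomalousDissipation/Theorems/<Name>.lean.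
-/

namespace Summit.AnomalousDissipation.AnomalousDissipation.Theses.FiniteIntersection

open scoped BigOperators Topology Manifold Classical MeasureTheory ProbabilityTheory Matrix InnerProductSpace ComplexConjugate ContinuousMap
open Filter Set Function TopologicalSpace MeasureTheory

attribute [summit_statement] _root_.AnomalousDissipation

open Literature.Turb

/-- item stmt-AnomalousDissipation-1327 · target · rank 0 · open · by planner
why it might fail: CoherentThesis(0218), finitary: Onsager-rough periodic orbits at small ν under O(1) C^∞-box forces with N-uniform budgets+ladders; rigorous anomalies all use ν-tied rough/time-dependent forces (BDL2023 Thm 1.1, Cheskidov2023 Thm 1.3/2.1); ladders break at bifurcations (VanVeenKidaKawahara2006 p.7).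
sources: BrueDeLellis2023 = arXiv:2207.06301 Thm 1.1; p.5 Questions 1-2 (nu-independent / time-independent force: open), Cheskidov2023 = arXiv:2311.04182 Thm 1.3 p.5 (time-periodic u^{nu_j}, time-dependent f^{nu_j} -> f in C(R;L^2)), Thm 2.1 p.8, §1.2, VanVeenKidaKawahara2006 = arXiv:1804.00547 p.7 L98-99 ('about half the continuations we ran ended in a bifurcation point'), item stmt-AnomalousDissipation-0218 (CoherentThesis; FM <=> 0218 in this class), decl Literature.Barriers.AnomalousDissipation.DrivasEyink2019_lemma1
[target] Thesis X = FM ('N viscosities, one force', idea card nu-independence-finite-intersection):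
∃ ν_j→0, a C^∞ force box B_R (all derivatives of the periodic lift ≤ R_k), budgets E, ε>0 and rung
ladders (period bound τmax_j, space-time C^k bounds M_{j,k}) such that for EVERY N some f_N ∈ B_R
(free to depend on N) carries at each ν_0..ν_N a classical time-periodic NS solution on ℝ×T³ within
the ladders with limsup-mean energy ≤ E and limsup-mean dissipation ≥ ε. Equivalent (in this class)
to CoherentStates' target 0218: 0218 ⇒ FM trivially (f_N := f), FM ⇒ 0218 by the Assembly (compact
box + fixed-ν closedness + diagonal = finite-intersection property). Each fixed rung FM_N alone is
trivial (Leray–Schauder steady states, dissipation (f,u_ν)>0); the content is uniformity of (E, ε,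
ladders) in N. FM = SVL ∧ ViscosityStacking (items of this route). -/
@[route_item "route-AnomalousDissipation-FiniteIntersection"]
def FiniteViscosityMultiplexing : Prop :=
  ∃ (ν : ℕ → ℝ) (R : ℕ → ℝ) (τmax : ℕ → ℝ) (M : ℕ → ℕ → ℝ) (E ε : ℝ), (∀ j, 0 < ν j) ∧ Filter.Tendsto ν Filter.atTop (nhds 0) ∧ 0 < ε ∧ ∀ N : ℕ, ∃ f : UnitAddTorus (Fin 3) → EuclideanSpace ℝ (Fin 3), (Literature.Analysis.FunctionSpaces.Torus.IsSmooth f ∧ Literature.Analysis.FunctionSpaces.Torus.IsDivFree f ∧ Literature.Analysis.FunctionSpaces.Torus.HasZeroMean f ∧ ∀ (k : ℕ) (y : EuclideanSpace ℝ (Fin 3)), ‖iteratedFDeriv ℝ k (Literature.Analysis.FunctionSpaces.Torus.lift f) y‖ ≤ R k) ∧ ∀ j : ℕ, j ≤ N → ∃ (τ : ℝ) (u : ℝ → UnitAddTorus (Fin 3) → EuclideanSpace ℝ (Fin 3)) (p : ℝ → UnitAddTorus (Fin 3) → ℝ), 0 < τ ∧ τ ≤ τmax j ∧ Literature.Analysis.FunctionSpaces.Torus.IsClassicalNSSolutionOn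 Set.univ (ν j) (fun _ => f) u p ∧ Function.Periodic u τ ∧ (∀ (k : ℕ) (z : ℝ × EuclideanSpace ℝ (Fin 3)), ‖iteratedFDeriv ℝ k (Literature.Analysis.FunctionSpaces.Torus.stLift u) z‖ ≤ M j k) ∧ Literature.Analysis.FluidPDE.meanEnergy u ≤ E ∧ ε ≤ Literature.Analysis.FluidPDE.meanDissipation (ν j) u

/-- item stmt-AnomalousDissipation-1328 · crux · rank 2 · open · by planner
why it might fail: Print puts the fine scales INTO ν-tied forces (Cheskidov2023 Thm 1.3: periodic, time-dependent f, f^ν→f in C_tL² only; BDL2023 Thm 1.1); laminar states reach ε only at wavenumber ∼(ε/ν)^½, outside any C¹ box — a bounded-energy cascade under O(1) smooth steady force is open at each ν; false in 2-D.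
sources: Cheskidov2023 = arXiv:2311.04182 Thm 1.3 p.5, Thm 2.1 p.8, §1.2 pp.4-5 ('remains an important open problem'), BrueDeLellis2023 = arXiv:2207.06301 Thm 1.1; p.5 Questions 1-2, arXiv:2605.18126 (Li 2026: structural stability of the BDL construction; forces still nu-indexed and only C^alpha-bounded; frontier check 2026-08-15, does not reach fixed C^infty boxes), decl Literature.Barriers.AnomalousDissipation.AlexakisDoering2006_energyDissipationBound (2-D: K_nu empty at small nu), decl Literature.Barriers.AnomalousDissipation.ForceRobustNoAnomalyNarrow (un-refuted negative residual where a proof of not-SVL would live), BergBredenLessardVeen2021 Thm 1.1 (computer-assisted periodic orbit at ONE nu, 2-D: the only certified-UPO technology)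
[crux, rank 2 — rung 1, SVL 'uniformly smooth single-viscosity designer forces'] ∃ ν_j→0, ONE C^∞
box B_R and budgets E, ε>0 such that for every j SOME force f_j ∈ B_R (re-tunable per j!) drives a
classical time-periodic NS_{ν_j} solution on ℝ×T³ with limsup-mean energy ≤ E and limsup-mean
dissipation ≥ ε (no ladders needed: one orbit per j). Necessary for FM (FM → SVL proved in planner
Sketch.lean) and for CoherentThesis 0218; strictly weaker than both (f may depend on ν) and strictly
beyond print: the designer forces of BrueDeLellis2023 Thm 1.1 / Cheskidov2023 Thm 2.1 / BCCDS2024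
converge only in C_tC^α and leave every C¹ box, because they build the dissipative scales INTO the
force; in a fixed box f = ∂_t u + P(u·∇u) − νΔu must stay smooth while ‖νΔu‖_{L²} ∼ ε^{3/4}ν^{-1/4}
→ ∞ (K41 field), i.e. the nonlinearity must run a genuine cascade — but with the force free to be
re-designed at each ν (fixed-ν tools: continuation and computer-assisted proof of UPOs à la
BergBredenLessardVeen2021, perturbation theory around explicit flows at each fixed ν). Why it might
fail: see why_might_fail. Negative side (¬SVL for all boxes) would refute CoherentThesis and is NOT
blocked by the force-r -/
@[route_item "route-AnomalousDissipation-FiniteIntersection", crux]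
def SingleViscosityLoudness : Prop :=
  ∃ (ν : ℕ → ℝ) (R : ℕ → ℝ) (E ε : ℝ), (∀ j, 0 < ν j) ∧ Filter.Tendsto ν Filter.atTop (nhds 0) ∧ 0 < ε ∧ ∀ j : ℕ, ∃ f : UnitAddTorus (Fin 3) → EuclideanSpace ℝ (Fin 3), (Literature.Analysis.FunctionSpaces.Torus.IsSmooth f ∧ Literature.Analysis.FunctionSpaces.Torus.IsDivFree f ∧ Literature.Analysis.FunctionSpaces.Torus.HasZeroMean f ∧ ∀ (k : ℕ) (y : EuclideanSpace ℝ (Fin 3)), ‖iteratedFDeriv ℝ k (Literature.Analysis.FunctionSpaces.Torus.lift f) y‖ ≤ R k) ∧ ∃ (τ : ℝ) (u : ℝ → UnitAddTorus (Fin 3) → EuclideanSpace ℝ (Fin 3)) (p : ℝ → UnitAddTorus (Fin 3) → ℝ), 0 < τ ∧ Literature.Analysis.FunctionSpaces.Torus.IsClassicalNSSolutionOn Set.univ (ν j) (fun _ => f) u p ∧ Function.Periodic u τ ∧ Literature.Analysis.FluidPDE.meanEnergy u ≤ E ∧ ε ≤ Literature.Analysis.FluidPDE.meanDissipation (ν j)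 u

/-- item stmt-AnomalousDissipation-1329 · crux · rank 3 · open · by planner
why it might fail: No tool couples two viscosities: a box force loud at ν₁ may laminarise/lose its bounded orbit at ν₂≪ν₁; K_ν closed, not convex (no Helly/KKM); N-uniform ladders (τmax_j, M_{j,k}) may have to blow up — VanVeenKidaKawahara2006 p.7: about half the ν-continuations of UPOs ended in a bifurcation point.
sources: VanVeenKidaKawahara2006 = arXiv:1804.00547 p.7 L98-99 (verified quote); pp.6-7 (Kida-flow UPO continuation over 0.0035<nu<0.0045), Cheskidov2023 = arXiv:2311.04182 §1.2 p.5 (after Thm 1.3: the constructed periodic solutions 'might lose stability' at large Re), KanedaEtAl2003 (epsilon plateau in DNS: evidence FOR co-smallness of the quiet sets), LucasKerswell2017 = doi:10.1017/jfm.2017.97, decl Literature.Barriers.AnomalousDissipation.Cheskidov2023_thm13_not_forceRobustNoAnomaly (scope caveat (f): nu-dependent periods fall outside the refuted class), DebruijnErdos1951 = doi:10.1016/s1385-7258(51)50053-7 (compactness-transfer template)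
[crux, rank 3 — the finite coupling of viscosities] SVL → FM: from per-viscosity loud box forces
(rung 1) to ONE box force loud at ν_0,…,ν_N simultaneously for every N, with N-uniform budgets and
rung ladders (box/budgets/sequence may be changed in the conclusion). This is ν-independence of the
force in finitary form — the smallest statement in which two Reynolds numbers must be served by the
same O(1)-scale force; by the Assembly nothing more is needed. Structure available: B_R is convex
and compact, each loud set K_ν ⊂ B_R is closed (ClosedLoudSet) — but not convex, so no Helly/KKM;
FM_N ⟺ the relatively open quiet sets Q_ν = B_R∖K_ν, ν ∈ {ν_0..ν_N}, do not cover B_R. Physical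
expectation (K41 plateau KanedaEtAl2003; UPOs embedded in the attractor reproduce ε:
VanVeenKidaKawahara2006, LucasKerswell2017): Q_ν is SMALL at every small ν, far more than 'not
covering'. A prover may of course ignore the hypothesis and prove FM outright; a refuter needs
SVL-true-but-FM-false: loud designs that are mutually incompatible across viscosities, or
unavoidable ladder blow-up (periods/C^k norms at FIXED rung j along every box sequence f_N). -/
@[route_item "route-AnomalousDissipation-FiniteIntersection", crux]
def ViscosityStacking : Prop :=
  (∃ (ν : ℕ → ℝ) (R : ℕ → ℝ) (E ε : ℝ), (∀ j, 0 < ν j) ∧ Filter.Tendsto ν Filter.atTop (nhds 0) ∧ 0 < ε ∧ ∀ j : ℕ, ∃ f : UnitAddTorus (Fin 3) → EuclideanSpace ℝ (Fin 3), (Literature.Analysis.FunctionSpaces.Torus.IsSmooth f ∧ Literature.Analysis.FunctionSpaces.Torus.IsDivFree f ∧ Literature.Analysis.FunctionSpaces.Torus.HasZeroMean f ∧ ∀ (k : ℕ) (y : EuclideanSpace ℝ (Fin 3)), ‖iteratedFDeriv ℝ k (Literature.Analysis.FunctionSpaces.Torus.lift f) y‖ ≤ R k) ∧ ∃ (τ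 : ℝ) (u : ℝ → UnitAddTorus (Fin 3) → EuclideanSpace ℝ (Fin 3)) (p : ℝ → UnitAddTorus (Fin 3) → ℝ), 0 < τ ∧ Literature.Analysis.FunctionSpaces.Torus.IsClassicalNSSolutionOn Set.univ (ν j) (fun _ => f) u p ∧ Function.Periodic u τ ∧ Literature.Analysis.FluidPDE.meanEnergy u ≤ E ∧ ε ≤ Literature.Analysis.FluidPDE.meanDissipation (ν j) u) → ∃ (ν : ℕ → ℝ) (R : ℕ → ℝ) (τmax : ℕ → ℝ) (M : ℕ → ℕ → ℝ) (E ε : ℝ), (∀ j, 0 < ν j) ∧ Filter.Tendsto ν Filter.atTop (nhds 0) ∧ 0 < ε ∧ ∀ N : ℕ, ∃ f : UnitAddTorus (Fin 3) → EuclideanSpace ℝ (Fin 3), (Literature.Analysis.FunctionSpaces.Torus.IsSmooth f ∧ Literature.Analysis.FunctionSpaces.Torus.IsDivFree f ∧ Literature.Analysis.FunctionSpaces.Torus.HasZeroMean f ∧ ∀ (k : ℕ) (y : EuclideanSpace ℝ (Fin 3)), ‖iteratedFDeriv ℝ k (Literature.Analysis.FunctionSpaces.Torus.lift f) y‖ ≤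 R k) ∧ ∀ j : ℕ, j ≤ N → ∃ (τ : ℝ) (u : ℝ → UnitAddTorus (Fin 3) → EuclideanSpace ℝ (Fin 3)) (p : ℝ → UnitAddTorus (Fin 3) → ℝ), 0 < τ ∧ τ ≤ τmax j ∧ Literature.Analysis.FunctionSpaces.Torus.IsClassicalNSSolutionOn Set.univ (ν j) (fun _ => f) u p ∧ Function.Periodic u τ ∧ (∀ (k : ℕ) (z : ℝ × EuclideanSpace ℝ (Fin 3)), ‖iteratedFDeriv ℝ k (Literature.Analysis.FunctionSpaces.Torus.stLift u) z‖ ≤ M j k) ∧ Literature.Analysis.FluidPDE.meanEnergy u ≤ E ∧ ε ≤ Literature.Analysis.FluidPDE.meanDissipation (ν j) u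

/-- item stmt-AnomalousDissipation-1330 · support · rank 9 · open · by planner
sources: Wang2009 = doi:10.3934/dcds.2009.23.521, FMRT2001 Ch. IV §1.3, Mathlib BoundedContinuousFunction.arzela_ascoli, theorem Literature.Turb.tendsto_timeMean_of_periodic (Summits/AnomalousDissipation/AnomalousDissipation/Theorems/EulerLimitCesaro.lean), theorem Literature.Analysis.FunctionSpaces.Torus.gradNormSq_eq_toReal_eGradNormSq_holds
[support, provable now] Fixed-ν closedness of the budgeted loud set: ν>0, box R, period bound τmax,
space-time C^k ladder M, budgets (E, ε); if box forces f_n → f uniformly (lifts) and each f_n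
carries a classical τ_n-periodic NS_ν orbit (u_n,p_n) on ℝ×T³ with 0<τ_n≤τmax, ‖D^k(stLift u_n)‖ ≤
M_k, meanEnergy ≤ E, meanDissipation ≥ ε, then so does f. Proof (~400-700 lines): normalise p_n to
spatial mean zero (same gradient, still classical); from the equation and the box bounds on f_n,
∇p_n and all its space-time derivatives are bounded, hence p_n (Poincaré on T³); Arzelà–Ascoli on
[−L,L]×T³ for (u_n, p_n) and all derivatives + diagonal in (L,k) ⇒ locally uniform C^∞ convergence
to (u,p); the momentum equation, div u = 0 pass pointwise (f_n → f uniformly suffices); τ_n → τ* ∈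
[0,τmax] along the subsequence: if τ*>0 then u is τ*-periodic, if τ*=0 then u is steady hence
τmax-periodic (τmax ≥ τ_n > 0); C^k bounds pass; budgets: meanEnergy/meanDissipation of a continuous
periodic integrand = period mean (PROVED Literature.Turb.tendsto_timeMean_of_periodic,
Theorems/EulerLimitCesaro.lean) and period means converge under C¹-uniform convergence (spectral =
classical enstrophy for smooth sli -/
@[route_item "route-AnomalousDissipation-FiniteIntersection", crux]
def ClosedLoudSet : Prop :=
  ∀ (ν : ℝ) (R : ℕ → ℝ) (τmax : ℝ) (M : ℕ → ℝ) (E ε : ℝ) (fs : ℕ → UnitAddTorus (Fin 3) → EuclideanSpace ℝ (Fin 3)) (f : UnitAddTorus (Fin 3) → EuclideanSpace ℝ (Fin 3)), 0 < ν → (∀ n, Literature.Analysis.FunctionSpaces.Torus.IsSmooth (fs n) ∧ Literature.Analysis.FunctionSpaces.Torus.IsDivFree (fs n) ∧ Literature.Analysis.FunctionSpaces.Torus.HasZeroMean (fs n) ∧ ∀ (k : ℕ) (y : EuclideanSpace ℝ (Fin 3)), ‖iteratedFDeriv ℝ k (Literature.Analysis.FunctionSpaces.Torus.lift (fs n)) y‖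 ≤ R k) → (Literature.Analysis.FunctionSpaces.Torus.IsSmooth f ∧ Literature.Analysis.FunctionSpaces.Torus.IsDivFree f ∧ Literature.Analysis.FunctionSpaces.Torus.HasZeroMean f ∧ ∀ (k : ℕ) (y : EuclideanSpace ℝ (Fin 3)), ‖iteratedFDeriv ℝ k (Literature.Analysis.FunctionSpaces.Torus.lift f) y‖ ≤ R k) → TendstoUniformly (fun n => Literature.Analysis.FunctionSpaces.Torus.lift (fs n)) (Literature.Analysis.FunctionSpaces.Torus.lift f) Filter.atTop → (∀ n, ∃ (τ : ℝ) (u : ℝ → UnitAddTorus (Fin 3) → EuclideanSpace ℝ (Fin 3)) (p : ℝ → UnitAddTorus (Fin 3) → ℝ), 0 < τ ∧ τ ≤ τmax ∧ Literature.Analysis.FunctionSpaces.Torus.IsClassicalNSSolutionOn Set.univ ν (fun _ => fs n) u p ∧ Function.Periodic u τ ∧ (∀ (k : ℕ) (z : ℝ × EuclideanSpace ℝ (Fin 3)), ‖iteratedFDeriv ℝ k (Literature.Analysis.FunctionSpaces.Torus.stLift u) z‖ ≤ M k) ∧ Literature.Analysis.FluidPDE.meanEnergy u ≤ E ∧ ε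 ≤ Literature.Analysis.FluidPDE.meanDissipation ν u) → ∃ (τ : ℝ) (u : ℝ → UnitAddTorus (Fin 3) → EuclideanSpace ℝ (Fin 3)) (p : ℝ → UnitAddTorus (Fin 3) → ℝ), 0 < τ ∧ τ ≤ τmax ∧ Literature.Analysis.FunctionSpaces.Torus.IsClassicalNSSolutionOn Set.univ ν (fun _ => f) u p ∧ Function.Periodic u τ ∧ (∀ (k : ℕ) (z : ℝ × EuclideanSpace ℝ (Fin 3)), ‖iteratedFDeriv ℝ k (Literature.Analysis.FunctionSpaces.Torus.stLift u) z‖ ≤ M k) ∧ Literature.Analysis.FluidPDE.meanEnergy u ≤ E ∧ ε ≤ Literature.Analysis.FluidPDE.meanDissipation ν u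

/-- item stmt-AnomalousDissipation-1331 · support · rank 9 · open · by planner
sources: Mathlib BoundedContinuousFunction.arzela_ascoli, FoiasTemam1977 (force-space topology at fixed ν, background)
[support, provable now] The C^∞ force box B_R = {f : IsSmooth, IsDivFree, HasZeroMean,
‖iteratedFDeriv ℝ k (lift f) y‖ ≤ R k ∀k,y} is sequentially compact for uniform convergence of the
periodic lifts: every sequence in B_R has a subsequence φ converging uniformly to some f ∈ B_R.
Proof (~300-500 lines): lifts are 1-periodic, so work on the compact cube (or on the compact torus):
equibounded (R 0) + equi-Lipschitz (R 1) ⇒ Arzelà–Ascoli (Mathlib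
BoundedContinuousFunction.arzela_ascoli) gives a uniformly convergent subsequence; repeat for each
derivative order and take the diagonal subsequence ⇒ all iteratedFDeriv converge uniformly, so the
limit is C^∞ with the same bounds (norm balls closed), derivatives of the limit = limits of
derivatives (Mathlib hasFDerivAt_of_tendstoUniformly-type lemmas), divergence-free passes under C¹
convergence and zero mean under uniform convergence. Only uniform C⁰ convergence is exported (all
ClosedLoudSet needs). Montel property of C^∞(T³) in disguise. -/
@[route_item "route-AnomalousDissipation-FiniteIntersection", crux]
def CompactForceBox : Prop :=
  ∀ (R : ℕ → ℝ) (fs : ℕ → UnitAddTorus (Fin 3) → EuclideanSpace ℝ (Fin 3)), (∀ n, Literature.Analysis.FunctionSpaces.Torus.IsSmooth (fs n) ∧ Literature.Analysis.FunctionSpaces.Torus.IsDivFree (fs n) ∧ Literature.Analysis.FunctionSpaces.Torus.HasZeroMean (fs n) ∧ ∀ (k : ℕ) (y : EuclideanSpace ℝ (Fin 3)), ‖iteratedFDeriv ℝ k (Literature.Analysis.FunctionSpaces.Torus.lift (fs n)) y‖ ≤ R k) → ∃ (f : UnitAddTorus (Fin 3) → EuclideanSpace ℝ (Fin 3)) (φ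 : ℕ → ℕ), StrictMono φ ∧ (Literature.Analysis.FunctionSpaces.Torus.IsSmooth f ∧ Literature.Analysis.FunctionSpaces.Torus.IsDivFree f ∧ Literature.Analysis.FunctionSpaces.Torus.HasZeroMean f ∧ ∀ (k : ℕ) (y : EuclideanSpace ℝ (Fin 3)), ‖iteratedFDeriv ℝ k (Literature.Analysis.FunctionSpaces.Torus.lift f) y‖ ≤ R k) ∧ TendstoUniformly (fun n => Literature.Analysis.FunctionSpaces.Torus.lift (fs (φ n))) (Literature.Analysis.FunctionSpaces.Torus.lift f) Filter.atTop

/-- item stmt-AnomalousDissipation-14146 · support · rank 9 · open · by planner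
sources: item stmt-AnomalousDissipation-1328 (SingleViscosityLoudness), item stmt-AnomalousDissipation-1329 (ViscosityStacking), item stmt-AnomalousDissipation-1327 (FiniteViscosityMultiplexing), DebruijnErdos1951 (compactness-transfer template of the route)
[support] GLUE of the two ranked cruxes into the target, BY NAME: SingleViscosityLoudness →
ViscosityStacking → FiniteViscosityMultiplexing. Since ViscosityStacking is verbatim (SVL-text →
FM-text), this is modus ponens after delta-unfolding — PROVED in the planner's Sketch.lean by the
one-line term `fun h₁ h₂ => h₂ h₁` (lean check rc 0, 2026-08-16); a prover lands it as `theorem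
multiplexingGlue_holds : MultiplexingGlue := fun h₁ h₂ => h₂ h₁`. Filed by the route-choice repair
(operator hold 2026-08-16, reason target-unreachable: no item concluded the target) so that the
target is reached from the cruxes by name and the deciding theorem `closes` CONSUMES the cruxes
(closes hS hV hG hCl hCo hA := hA (hG hS hV) hCl hCo) instead of assuming
FiniteViscosityMultiplexing. [deps: SingleViscosityLoudness, ViscosityStacking,
FiniteViscosityMultiplexing] [difficulty: provable-now] -/
@[route_item "route-AnomalousDissipation-FiniteIntersection", crux]
def MultiplexingGlue : Prop :=
  SingleViscosityLoudness → ViscosityStacking → FiniteViscosityMultiplexing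

/-- item stmt-AnomalousDissipation-1332 · assembly · rank 1 · open · by planner
sources: theorem AnomalousDissipation.CoherentStates.coherent_assembly_fact, theorem Literature.Analysis.FluidPDE.Torus.isGlobalLerayHopf_of_isClassicalNSSolutionOn_holds, DebruijnErdos1951 (template)
[assembly] FM → ClosedLoudSet → CompactForceBox → AnomalousDissipation (hypotheses inlined verbatim
= items FiniteViscosityMultiplexing, ClosedLoudSet, CompactForceBox). Proof map (~150-250 lines, the
finite-intersection/diagonal argument): choose f_N from FM; CompactForceBox gives φ strictly
increasing and f* ∈ B_R with lift f_{φ n} → lift f* uniformly; for each rung j apply ClosedLoudSet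
at ν_j (0<ν_j) to the shifted sequence n ↦ f_{φ(n+j)} (φ(n+j) ≥ j, so rung j is served; a tail of a
uniformly convergent sequence converges) ⇒ f* carries a loud bounded periodic classical orbit (τ_j,
u_j, p_j) at every ν_j with meanEnergy ≤ E, meanDissipation ≥ ε; with IsSmooth/IsDivFree/HasZeroMean
f* from the box this is VERBATIM the CoherentStates target (0218), and AnomalousDissipation follows
from the PROVED theorems _root_.AnomalousDissipation.CoherentStates.coherent_assembly_fact
(Theorems/CoherentStatesAssembly.lean) applied to
Literature.Analysis.FluidPDE.Torus.isGlobalLerayHopf_of_isClassicalNSSolutionOn_holds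
(TorusClassicalLerayHopfProofs.lean) — checked in planner Sketch.lean. Imports for the Theorems
file: Summits.AnomalousDissipation.AnomalousDissipation.Theorems.CoherentStatesAsse -/
@[route_item "route-AnomalousDissipation-FiniteIntersection", crux]
def Assembly : Prop :=
  (∃ (ν : ℕ → ℝ) (R : ℕ → ℝ) (τmax : ℕ → ℝ) (M : ℕ → ℕ → ℝ) (E ε : ℝ), (∀ j, 0 < ν j) ∧ Filter.Tendsto ν Filter.atTop (nhds 0) ∧ 0 < ε ∧ ∀ N : ℕ, ∃ f : UnitAddTorus (Fin 3) → EuclideanSpace ℝ (Fin 3), (Literature.Analysis.FunctionSpaces.Torus.IsSmooth f ∧ Literature.Analysis.FunctionSpaces.Torus.IsDivFree f ∧ Literature.Analysis.FunctionSpaces.Torus.HasZeroMean f ∧ ∀ (k : ℕ) (y : EuclideanSpace ℝ (Fin 3)), ‖iteratedFDeriv ℝ k (Literature.Analysis.FunctionSpaces.Torus.lift f) y‖ ≤ R k) ∧ ∀ j : ℕ, j ≤ N → ∃ (τ : ℝ) (u : ℝ → UnitAddTorus (Fin 3) → EuclideanSpace ℝ (Fin 3)) (p : ℝ → UnitAddTorus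 (Fin 3) → ℝ), 0 < τ ∧ τ ≤ τmax j ∧ Literature.Analysis.FunctionSpaces.Torus.IsClassicalNSSolutionOn Set.univ (ν j) (fun _ => f) u p ∧ Function.Periodic u τ ∧ (∀ (k : ℕ) (z : ℝ × EuclideanSpace ℝ (Fin 3)), ‖iteratedFDeriv ℝ k (Literature.Analysis.FunctionSpaces.Torus.stLift u) z‖ ≤ M j k) ∧ Literature.Analysis.FluidPDE.meanEnergy u ≤ E ∧ ε ≤ Literature.Analysis.FluidPDE.meanDissipation (ν j) u) → (∀ (ν : ℝ) (R : ℕ → ℝ) (τmax : ℝ) (M : ℕ → ℝ) (E ε : ℝ) (fs : ℕ → UnitAddTorus (Fin 3) → EuclideanSpace ℝ (Fin 3)) (f : UnitAddTorus (Fin 3) → EuclideanSpace ℝ (Fin 3)), 0 < ν → (∀ n, Literature.Analysis.FunctionSpaces.Torus.IsSmooth (fs n) ∧ Literature.Analysis.FunctionSpaces.Torus.IsDivFree (fs n) ∧ Literature.Analysis.FunctionSpaces.Torus.HasZeroMean (fs n) ∧ ∀ (k : ℕ) (y : EuclideanSpace ℝ (Fin 3)), ‖iteratedFDeriv ℝ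 k (Literature.Analysis.FunctionSpaces.Torus.lift (fs n)) y‖ ≤ R k) → (Literature.Analysis.FunctionSpaces.Torus.IsSmooth f ∧ Literature.Analysis.FunctionSpaces.Torus.IsDivFree f ∧ Literature.Analysis.FunctionSpaces.Torus.HasZeroMean f ∧ ∀ (k : ℕ) (y : EuclideanSpace ℝ (Fin 3)), ‖iteratedFDeriv ℝ k (Literature.Analysis.FunctionSpaces.Torus.lift f) y‖ ≤ R k) → TendstoUniformly (fun n => Literature.Analysis.FunctionSpaces.Torus.lift (fs n)) (Literature.Analysis.FunctionSpaces.Torus.lift f) Filter.atTop → (∀ n, ∃ (τ : ℝ) (u : ℝ → UnitAddTorus (Fin 3) → EuclideanSpace ℝ (Fin 3)) (p : ℝ → UnitAddTorus (Fin 3) → ℝ), 0 < τ ∧ τ ≤ τmax ∧ Literature.Analysis.FunctionSpaces.Torus.IsClassicalNSSolutionOn Set.univ ν (fun _ => fs n) u p ∧ Function.Periodic u τ ∧ (∀ (k : ℕ) (z : ℝ × EuclideanSpace ℝ (Fin 3)), ‖iteratedFDeriv ℝ k (Literature.Analysis.FunctionSpaces.Torus.stLift u) z‖ ≤ M k) ∧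 Literature.Analysis.FluidPDE.meanEnergy u ≤ E ∧ ε ≤ Literature.Analysis.FluidPDE.meanDissipation ν u) → ∃ (τ : ℝ) (u : ℝ → UnitAddTorus (Fin 3) → EuclideanSpace ℝ (Fin 3)) (p : ℝ → UnitAddTorus (Fin 3) → ℝ), 0 < τ ∧ τ ≤ τmax ∧ Literature.Analysis.FunctionSpaces.Torus.IsClassicalNSSolutionOn Set.univ ν (fun _ => f) u p ∧ Function.Periodic u τ ∧ (∀ (k : ℕ) (z : ℝ × EuclideanSpace ℝ (Fin 3)), ‖iteratedFDeriv ℝ k (Literature.Analysis.FunctionSpaces.Torus.stLift u) z‖ ≤ M k) ∧ Literature.Analysis.FluidPDE.meanEnergy u ≤ E ∧ ε ≤ Literature.Analysis.FluidPDE.meanDissipation ν u) → (∀ (R : ℕ → ℝ) (fs : ℕ → UnitAddTorus (Fin 3) → EuclideanSpace ℝ (Fin 3)), (∀ n, Literature.Analysis.FunctionSpaces.Torus.IsSmooth (fs n) ∧ Literature.Analysis.FunctionSpaces.Torus.IsDivFree (fs n) ∧ Literature.Analysis.FunctionSpaces.Torus.HasZeroMean (fs n) ∧ ∀ (k : ℕ)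 (y : EuclideanSpace ℝ (Fin 3)), ‖iteratedFDeriv ℝ k (Literature.Analysis.FunctionSpaces.Torus.lift (fs n)) y‖ ≤ R k) → ∃ (f : UnitAddTorus (Fin 3) → EuclideanSpace ℝ (Fin 3)) (φ : ℕ → ℕ), StrictMono φ ∧ (Literature.Analysis.FunctionSpaces.Torus.IsSmooth f ∧ Literature.Analysis.FunctionSpaces.Torus.IsDivFree f ∧ Literature.Analysis.FunctionSpaces.Torus.HasZeroMean f ∧ ∀ (k : ℕ) (y : EuclideanSpace ℝ (Fin 3)), ‖iteratedFDeriv ℝ k (Literature.Analysis.FunctionSpaces.Torus.lift f) y‖ ≤ R k) ∧ TendstoUniformly (fun n => Literature.Analysis.FunctionSpaces.Torus.lift (fs (φ n))) (Literature.Analysis.FunctionSpaces.Torus.lift f) Filter.atTop) → AnomalousDissipation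

/-! D-0027 §2.1 — DECIDING THEOREM (planner-authored via `route open/edit --closes-file`; by planner-rchoice-AnomalousDissipation-FiniteInt-1dfcaf58-0 2026-08-16T03:04:40Z):
its hypotheses are this route's items and its conclusion the sub-problem Statement (glue_lint), and it elaborates with this file. -/

/-- D-0027 §2.1 deciding theorem of route FiniteIntersection (route-choice (a), 2026-08-16; replaces the
rev-2 theorem, which assumed the target and ignored both cruxes): the two RANKED CRUXES give the target
X = `FiniteViscosityMultiplexing` through the by-name glue item `MultiplexingGlue` (rung 1
`SingleViscosityLoudness`, then the finite coupling of viscosities `ViscosityStacking : SVL → FM`);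
the `Assembly` item (the finite-intersection / diagonal argument FM → ClosedLoudSet → CompactForceBox →
AnomalousDissipation, hypotheses inlined verbatim, defeq to the named items) then yields the Statement from
the two soft supports `ClosedLoudSet` (fixed-ν closedness of the budgeted loud set) and `CompactForceBox`
(Arzelà–Ascoli compactness of the C^∞ force box). Pure logic; every crux is consumed, the target is not assumed. -/
@[closes "route-AnomalousDissipation-FiniteIntersection"] theorem closes (hS : SingleViscosityLoudness) (hV : ViscosityStacking) (hG : MultiplexingGlue)
    (hCl : ClosedLoudSet) (hCo : CompactForceBox) (hA : Assembly) : _root_.AnomalousDissipation :=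
  hA (hG hS hV) hCl hCo

end Summit.AnomalousDissipation.AnomalousDissipation.Theses.FiniteIntersection
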